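import Mathlib.Algebra.Order.Chebyshev
import Literature.NumberTheory.DiophantineGeometry.ShuteFourSquarefulHolder

/-!
# Shute (2021), §3: counting lemmas for the fourth moment (one Cauchy–Schwarz and its slices)

Second companion to `ShuteFourSquareful.lean` (named fact `Shute2021_prop32` = Shute's Prop. 3.2)
after `ShuteFourSquarefulHolder.lean`. With `P = pts X Y` the parameter points and
`val (x, y) = x²y³`, the fourth moment is
`N(X, Y) = #{((p₁, p₃), (p₁', p₃')) ∈ (P²)² : val p₁ − val p₃ = val p₁' − val p₃'}`
(`Shute2021.fourthMoment_eq_diffEnergy`). This file contains the exact (integer) part of the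
elementary bound `N(X, Y) ≪_ε X^{2+ε} Y^{3+ε}` completed in `ShuteFourSquarefulMoment.lean`:

1. *Monochromatic Cauchy–Schwarz* (`Shute2021.coll_self_le_card_mul`): for a colouring `c` with
   values in `K`, `coll(U, U; φ) ≤ #K · coll(U, U; (φ, c))`. Colouring a pair `(p₁, p₃)` by
   `y₁ ∈ [−Y, Y]` gives `N(X, Y) ≤ (2Y + 1) · K(X, Y)` (`Shute2021.diffEnergy_le_mul_monoCount`),
   where `K = Shute2021.monoCount X Y` counts the solutions of
   `y₁³ (x₁² − x₁'²) = x₃²y₃³ − x₃'²y₃'³`.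
2. *Slices* (`Shute2021.monoCount_eq_sum`): `K = Σ_{t = (p₃, p₃')} G(t)` with
   `G = Shute2021.sliceCount`. Diagonal `t` (`val p₃ = val p₃'`): `G(t) ≤ 2 #P`
   (`sliceCount_le_of_eq`: `y₁ = y₁'` and `x₁²y₁³ = x₁'²y₁³` force `x₁' = ±x₁`), and there are
   `≤ Σ_{p'} 4τ(|val p'|)` diagonal `t` (`card_filter_val_eq_val_le`: `y ∣ n`, `x = ±√(n/y³)`).
   Off-diagonal `t` (`m = val p₃ − val p₃' ≠ 0`): `G(t) ≤ 2τ(|m|) · 2τ(|m|)` (`sliceCount_le_of_ne`: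
   `(y₁, x₁, x₁')` determines the slice element, `y₁ ∣ m`, `(x₁ − x₁')(x₁ + x₁') = m / y₁³`).
3. The divisor-type counts behind 2 (`Shute2021.tau m = τ(|m|)`): at most `2τ(|m|)` elements of
   a finite set divide `m ≠ 0` (`card_filter_dvd_le`); `#{a² − b² = n} ≤ 2τ(|n|)`
   (`card_filter_sq_sub_sq_le`); `#{x : x²k = n} ≤ 2` (`card_filter_sq_mul_eq_le_two`);
   `#{p ∈ P : val p = n} ≤ 4τ(|n|)` (`card_filter_val_eq_le`);
   `#{(y, a, b) : y³(a² − b²) = m} ≤ 2τ(|m|) · 2τ(|m|)` (`card_filter_cube_mul_le`).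

These are the counting steps "by the trivial estimate for the divisor function" of the source
(A. Shute, arXiv:2104.06966, §3, proof of Prop. 3.2), applied after ONE Cauchy–Schwarz instead
of the paper's two (see the module docstring of `ShuteFourSquarefulHolder.lean`).

## References

* A. Shute, *Sums of four squareful numbers*, arXiv:2104.06966 (2021), §3, proof of Prop. 3.2.
  [Shute2021]
-/

noncomputable section

open Finset

namespace Literature.NumberTheory.DiophantineGeometry

namespace Shute2021

/-! ### Monochromatic Cauchy–Schwarz -/

section Mono

variable {α M κ : Type*} [DecidableEq M] [DecidableEq κ]

/-- **Monochromatic Cauchy–Schwarz**: if `c : α → κ` takes values in `K` on `U`, then the number of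
`φ`-collisions on `U` is at most `#K` times the number of collisions that are ALSO `c`-collisions:
`coll(U, U; φ) ≤ #K · coll(U, U; (φ, c))`. [folklore] -/
theorem coll_self_le_card_mul (U : Finset α) (φ : α → M) (c : α → κ) (K : Finset κ)
    (hc : ∀ u ∈ U, c u ∈ K) :
    coll U U φ φ ≤ #K * coll U U (fun u => (φ u, c u)) (fun u => (φ u, c u)) := by
  classical
  set S : Finset M := U.image φ
  have hS : ∀ u ∈ U, φ u ∈ S := fun u hu => mem_image_of_mem φ hu
  have hSK : ∀ u ∈ U, (φ u, c u) ∈ S ×ˢ K := fun u hu => mem_product.2 ⟨hS u hu, hc u hu⟩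
  rw [coll_eq_sum U U φ φ hS, coll_eq_sum U U _ _ hSK, sum_product, mul_sum]
  refine sum_le_sum fun m _ => ?_
  -- fibre over the colour
  have hfib : #{u ∈ U | φ u = m} = ∑ k ∈ K, #{u ∈ U | (φ u, c u) = (m, k)} := by
    rw [card_eq_sum_card_fiberwise (f := c) (s := {u ∈ U | φ u = m}) (t := K)]
    · refine sum_congr rfl fun k _ => ?_
      rw [filter_filter]
      simp only [Prod.mk.injEq]
    · intro u hu
      have hu' := Finset.mem_coe.1 hu
      exact Finset.mem_coe.2 (hc u (mem_filter.1 hu').1)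
  rw [hfib, ← sq]
  calc (∑ k ∈ K, #{u ∈ U | (φ u, c u) = (m, k)}) ^ 2
      ≤ #K * ∑ k ∈ K, #{u ∈ U | (φ u, c u) = (m, k)} ^ 2 := sq_sum_le_card_mul_sum_sq
    _ = #K * ∑ k ∈ K, #{u ∈ U | (φ u, c u) = (m, k)} * #{u ∈ U | (φ u, c u) = (m, k)} := by
        simp_rw [sq]

end Mono

/-! ### Elementary divisor counting in `ℤ` -/

section Counting

/-- `τ(|m|)`, the number of positive divisors of the integer `m`. [folklore] -/
def tau (m : ℤ) : ℕ := #(Nat.divisors m.natAbs)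

/-- The signed divisors `±d`, `d ∣ |m|`, as a finset of integers. [folklore] -/
def intDivisors (m : ℤ) : Finset ℤ :=
  (Nat.divisors m.natAbs).image (fun d : ℕ => (d : ℤ)) ∪
    (Nat.divisors m.natAbs).image (fun d : ℕ => -(d : ℤ))

/-- Every integer divisor of `m ≠ 0` is a signed divisor. [folklore] -/
theorem mem_intDivisors {m d : ℤ} (hm : m ≠ 0) (hd : d ∣ m) : d ∈ intDivisors m := by
  have hnat : d.natAbs ∈ Nat.divisors m.natAbs :=
    Nat.mem_divisors.2 ⟨Int.natAbs_dvd_natAbs.2 hd, Int.natAbs_ne_zero.2 hm⟩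
  rcases Int.natAbs_eq d with h | h
  · exact mem_union_left _ (mem_image.2 ⟨d.natAbs, hnat, h.symm⟩)
  · exact mem_union_right _ (mem_image.2 ⟨d.natAbs, hnat, by rw [h]; simp⟩)

/-- There are at most `2 τ(|m|)` signed divisors. [folklore] -/
theorem card_intDivisors_le (m : ℤ) : #(intDivisors m) ≤ 2 * tau m := by
  unfold intDivisors tau
  calc _ ≤ #((Nat.divisors m.natAbs).image (fun d : ℕ => (d : ℤ))) +
        #((Nat.divisors m.natAbs).image (fun d : ℕ => -(d : ℤ))) := card_union_le _ _
    _ ≤ #(Nat.divisors m.natAbs) + #(Nat.divisors m.natAbs) :=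
        Nat.add_le_add card_image_le card_image_le
    _ = _ := by ring

/-- At most `2 τ(|m|)` elements of any finite set of integers divide `m ≠ 0`. [folklore] -/
theorem card_filter_dvd_le (S : Finset ℤ) {m : ℤ} (hm : m ≠ 0) :
    #{d ∈ S | d ∣ m} ≤ 2 * tau m :=
  (card_le_card fun _ hd => mem_intDivisors hm (mem_filter.1 hd).2).trans (card_intDivisors_le m)

/-- `τ(|n|) ≤ τ(|m|)` when `n ∣ m ≠ 0`. [folklore] -/
theorem tau_le_tau_of_dvd {n m : ℤ} (h : n ∣ m) (hm : m ≠ 0) : tau n ≤ tau m :=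
  card_le_card (Nat.divisors_subset_of_dvd (Int.natAbs_ne_zero.2 hm) (Int.natAbs_dvd_natAbs.2 h))

/-- At most two integers in any finite set satisfy `x² · k = n` (`k ≠ 0`). [folklore] -/
theorem card_filter_sq_mul_eq_le_two (S : Finset ℤ) {k : ℤ} (hk : k ≠ 0) (n : ℤ) :
    #{x ∈ S | x ^ 2 * k = n} ≤ 2 := by
  rcases ({x ∈ S | x ^ 2 * k = n} : Finset ℤ).eq_empty_or_nonempty with h | ⟨x₀, hx₀⟩
  · rw [h]; simp
  · have hx₀' := (mem_filter.1 hx₀).2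
    calc #{x ∈ S | x ^ 2 * k = n} ≤ #({x₀, -x₀} : Finset ℤ) := by
          refine card_le_card fun x hx => ?_
          have hx' := (mem_filter.1 hx).2
          have hsq : x ^ 2 = x₀ ^ 2 := mul_right_cancel₀ hk (hx'.trans hx₀'.symm)
          rcases sq_eq_sq_iff_eq_or_eq_neg.1 hsq with h | h
          · rw [h]; exact mem_insert_self _ _
          · rw [h]; exact mem_insert_of_mem (mem_singleton_self _)
      _ ≤ 2 := (card_insert_le _ _).trans (by simp)

/-- Counting a filtered product fibrewise over the first factor. [folklore] -/
theorem card_filter_product_left {α β : Type*} (A : Finset α) (B : Finset β) (p : α × β → Prop)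
    [DecidablePred p] : #{r ∈ A ×ˢ B | p r} = ∑ a ∈ A, #{b ∈ B | p (a, b)} := by
  rw [card_filter, sum_product]
  exact sum_congr rfl fun a _ => (card_filter _ _).symm

/-- Counting a filtered product fibrewise over the second factor. [folklore] -/
theorem card_filter_product_right {α β : Type*} (A : Finset α) (B : Finset β) (p : α × β → Prop)
    [DecidablePred p] : #{r ∈ A ×ˢ B | p r} = ∑ b ∈ B, #{a ∈ A | p (a, b)} := by
  rw [card_filter, sum_product_right]
  exact sum_congr rfl fun b _ => (card_filter _ _).symm

/-- For `n ≠ 0`, at most `2 τ(|n|)` pairs `(a, b)` in a product of finite sets of integers satisfy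
`a² - b² = n` (the difference `a - b` is a signed divisor of `n` and determines the pair).
[folklore] -/
theorem card_filter_sq_sub_sq_le (S T : Finset ℤ) {n : ℤ} (hn : n ≠ 0) :
    #{r ∈ S ×ˢ T | r.1 ^ 2 - r.2 ^ 2 = n} ≤ 2 * tau n := by
  refine le_trans ?_ (card_intDivisors_le n)
  refine card_le_card_of_injOn (fun r => r.1 - r.2) ?_ ?_
  · intro r hr
    have h := (mem_filter.1 (mem_coe.1 hr)).2
    exact mem_coe.2 (mem_intDivisors hn ⟨r.1 + r.2, by linear_combination -h⟩)
  · intro r hr r' hr' hd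
    have h := (mem_filter.1 (mem_coe.1 hr)).2
    have h' := (mem_filter.1 (mem_coe.1 hr')).2
    have hfac : (r.1 - r.2) * (r.1 + r.2) = n := by linear_combination h
    have hfac' : (r.1 - r.2) * (r'.1 + r'.2) = n := by
      have : (r'.1 - r'.2) * (r'.1 + r'.2) = n := by linear_combination h'
      simpa only [show r.1 - r.2 = r'.1 - r'.2 from hd] using this
    have hd0 : r.1 - r.2 ≠ 0 := by
      intro h0
      rw [h0, zero_mul] at hfac
      exact hn hfac.symm
    have hsum : r.1 + r.2 = r'.1 + r'.2 := mul_left_cancel₀ hd0 (hfac.trans hfac'.symm)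
    have hd' : r.1 - r.2 = r'.1 - r'.2 := hd
    exact Prod.ext (by linarith) (by linarith)

/-- For `n ≠ 0`, at most `4 τ(|n|)` parameter points have value `x² y³ = n` (`y ∣ n`, then
`x = ±√(n/y³)`). [folklore] -/
theorem card_filter_val_eq_le (X Y : ℕ) {n : ℤ} (hn : n ≠ 0) :
    #{p ∈ pts X Y | val p = n} ≤ 4 * tau n := by
  unfold pts
  rw [card_filter_product_right,
    ← sum_filter_of_ne (p := fun y : ℤ => y ∣ n) (fun y _ hne => ?_)]
  · calc ∑ y ∈ ((Icc (-(Y : ℤ)) Y).filter fun y => y ≠ 0 ∧ Squarefree y.natAbs).filter (· ∣ n),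
          #{x ∈ (Icc (-(X : ℤ)) X).filter (fun x => x ≠ 0) | val (x, y) = n}
        ≤ ∑ y ∈ ((Icc (-(Y : ℤ)) Y).filter fun y => y ≠ 0 ∧ Squarefree y.natAbs).filter (· ∣ n),
            2 := by
          refine sum_le_sum fun y hy => ?_
          have hy0 : y ≠ 0 := (mem_filter.1 (mem_filter.1 hy).1).2.1
          exact card_filter_sq_mul_eq_le_two _ (pow_ne_zero 3 hy0) n
      _ ≤ 2 * (2 * tau n) := by
          rw [sum_const, smul_eq_mul, mul_comm]
          exact Nat.mul_le_mul_left 2 (card_filter_dvd_le _ hn)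
      _ = 4 * tau n := by ring
  · obtain ⟨x, hx⟩ := card_ne_zero.1 hne
    have hx' : x ^ 2 * y ^ 3 = n := (mem_filter.1 hx).2
    exact ⟨x ^ 2 * y ^ 2, by linear_combination -hx'⟩

/-- For `m ≠ 0` and finite sets `R ∌ 0`, `S`, `T` of integers, at most `2τ(|m|) · 2τ(|m|)` triples
`(y, a, b) ∈ R × S × T` satisfy `y³ (a² - b²) = m` (`y ∣ m`, then `a² - b² = m / y³`).
[folklore] -/
theorem card_filter_cube_mul_le (R S T : Finset ℤ) (hR : ∀ y ∈ R, y ≠ 0) {m : ℤ} (hm : m ≠ 0) :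
    #{w ∈ R ×ˢ (S ×ˢ T) | w.1 ^ 3 * (w.2.1 ^ 2 - w.2.2 ^ 2) = m} ≤ 2 * tau m * (2 * tau m) := by
  rw [card_filter_product_left,
    ← sum_filter_of_ne (p := fun y : ℤ => y ∣ m) (fun y _ hne => ?_)]
  · calc ∑ y ∈ R.filter (· ∣ m), #{r ∈ S ×ˢ T | y ^ 3 * (r.1 ^ 2 - r.2 ^ 2) = m}
        ≤ ∑ y ∈ R.filter (· ∣ m), 2 * tau m := by
          refine sum_le_sum fun y hy => ?_
          have hy0 : y ≠ 0 := hR y (mem_filter.1 hy).1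
          rcases ({r ∈ S ×ˢ T | y ^ 3 * (r.1 ^ 2 - r.2 ^ 2) = m} : Finset (ℤ × ℤ)).eq_empty_or_nonempty
            with h | ⟨r₀, hr₀⟩
          · rw [h]; simp
          · set d : ℤ := r₀.1 ^ 2 - r₀.2 ^ 2 with hd
            have hdm : y ^ 3 * d = m := (mem_filter.1 hr₀).2
            have hd0 : d ≠ 0 := by rintro h0; rw [h0, mul_zero] at hdm; exact hm hdm.symm
            have hsub : {r ∈ S ×ˢ T | y ^ 3 * (r.1 ^ 2 - r.2 ^ 2) = m} ⊆
                {r ∈ S ×ˢ T | r.1 ^ 2 - r.2 ^ 2 = d} := by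
              intro r hr
              rw [mem_filter] at hr ⊢
              exact ⟨hr.1, mul_left_cancel₀ (pow_ne_zero 3 hy0) (hr.2.trans hdm.symm)⟩
            calc _ ≤ #{r ∈ S ×ˢ T | r.1 ^ 2 - r.2 ^ 2 = d} := card_le_card hsub
              _ ≤ 2 * tau d := card_filter_sq_sub_sq_le S T hd0
              _ ≤ 2 * tau m := Nat.mul_le_mul_left 2 (tau_le_tau_of_dvd ⟨y ^ 3, by rw [← hdm]; ring⟩ hm)
      _ ≤ 2 * tau m * (2 * tau m) := by
          rw [sum_const, smul_eq_mul]
          exact Nat.mul_le_mul_right _ (card_filter_dvd_le _ hm)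
  · obtain ⟨r, hr⟩ := card_ne_zero.1 hne
    have hr' : y ^ 3 * (r.1 ^ 2 - r.2 ^ 2) = m := (mem_filter.1 hr).2
    exact ⟨y ^ 2 * (r.1 ^ 2 - r.2 ^ 2), by linear_combination -hr'⟩

end Counting

/-! ### One Cauchy–Schwarz in `y₁`, and the slices of the monochromatic count -/

section Slices

variable {X Y : ℕ}

/-- The `x`-range `{x : 0 < |x| ≤ X}`. [folklore] -/
def xdom (X : ℕ) : Finset ℤ := (Icc (-(X : ℤ)) X).filter fun x => x ≠ 0

/-- The `y`-range `{y : 0 < |y| ≤ Y, y square-free}`. [folklore] -/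
def ydom (Y : ℕ) : Finset ℤ := (Icc (-(Y : ℤ)) Y).filter fun y => y ≠ 0 ∧ Squarefree y.natAbs

/-- `pts X Y = xdom X ×ˢ ydom Y`. [folklore] -/
theorem pts_eq (X Y : ℕ) : pts X Y = xdom X ×ˢ ydom Y := rfl

/-- Elements of `ydom Y` are nonzero. [folklore] -/
theorem ne_zero_of_mem_ydom {y : ℤ} (hy : y ∈ ydom Y) : y ≠ 0 := (mem_filter.1 hy).2.1

/-- The value `x² y³` of a parameter point is nonzero. [folklore] -/
theorem val_ne_zero {p : ℤ × ℤ} (hp : p ∈ pts X Y) : val p ≠ 0 :=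
  mul_ne_zero (pow_ne_zero 2 (mem_pts.1 hp).1.2) (pow_ne_zero 3 (mem_pts.1 hp).2.2.1)

/-- `|x² y³| ≤ X² Y³` on `pts X Y`. [folklore] -/
theorem abs_val_le {p : ℤ × ℤ} (hp : p ∈ pts X Y) : |val p| ≤ (X : ℤ) ^ 2 * (Y : ℤ) ^ 3 := by
  obtain ⟨⟨hx, -⟩, hy, -⟩ := mem_pts.1 hp
  rw [val, abs_mul, abs_pow, abs_pow]
  exact mul_le_mul (pow_le_pow_left₀ (abs_nonneg _) hx 2) (pow_le_pow_left₀ (abs_nonneg _) hy 3)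
    (by positivity) (by positivity)

/-- The pair map `ψ(p₁, p₃) = (x₁²y₁³ − x₃²y₃³, y₁)` (value difference and the colour `y₁`).
[folklore] -/
def psi (q : (ℤ × ℤ) × (ℤ × ℤ)) : ℤ × ℤ := (val q.1 - val q.2, q.1.2)

/-- The **monochromatic count** `K(X, Y) = #{((p₁, p₃), (p₁', p₃')) : x₁²y₁³ − x₃²y₃³ =
x₁'²y₁'³ − x₃'²y₃'³, y₁ = y₁'}`, i.e. the solutions of `y₁³(x₁² − x₁'²) = x₃²y₃³ − x₃'²y₃'³`.
[folklore] -/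
def monoCount (X Y : ℕ) : ℕ :=
  coll (pts X Y ×ˢ pts X Y) (pts X Y ×ˢ pts X Y) psi psi

/-- **One Cauchy–Schwarz in `y₁`**: `N(X, Y) ≤ (2Y + 1) · K(X, Y)`. [folklore] -/
theorem diffEnergy_le_mul_monoCount (X Y : ℕ) :
    diffEnergy val (pts X Y) ≤ (2 * Y + 1) * monoCount X Y := by
  have h := coll_self_le_card_mul (pts X Y ×ˢ pts X Y) (fun q => val q.1 - val q.2)
    (fun q => q.1.2) (Icc (-(Y : ℤ)) Y) fun q hq => by
      have hy := (mem_pts.1 (mem_product.1 hq).1).2.1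
      exact mem_Icc.2 (abs_le.1 hy)
  have hcard : #(Icc (-(Y : ℤ)) Y) = 2 * Y + 1 := by
    rw [Int.card_Icc, show (Y : ℤ) + 1 - -(Y : ℤ) = ((2 * Y + 1 : ℕ) : ℤ) by push_cast; ring,
      Int.toNat_natCast]
  rw [hcard] at h
  exact h

/-- The slice `G(t)` of the monochromatic count at `t = (p₃, p₃')`:
`#{(p₁, p₁') : x₁²y₁³ − x₁'²y₁'³ = val p₃ − val p₃', y₁ = y₁'}`. [folklore] -/
def sliceCount (X Y : ℕ) (t : (ℤ × ℤ) × (ℤ × ℤ)) : ℕ :=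
  #{s ∈ pts X Y ×ˢ pts X Y | val s.1 - val s.2 = val t.1 - val t.2 ∧ s.1.2 = s.2.2}

/-- `K(X, Y) = Σ_t G(t)` (reindex `((p₁, p₃), (p₁', p₃')) ↦ ((p₁, p₁'), (p₃, p₃'))` and count
fibrewise). [folklore] -/
theorem monoCount_eq_sum (X Y : ℕ) :
    monoCount X Y = ∑ t ∈ pts X Y ×ˢ pts X Y, sliceCount X Y t := by
  unfold monoCount coll
  calc _ = #{r ∈ (pts X Y ×ˢ pts X Y) ×ˢ (pts X Y ×ˢ pts X Y) |
        val r.1.1 - val r.1.2 = val r.2.1 - val r.2.2 ∧ r.1.1.2 = r.1.2.2} := by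
        refine card_equiv (Equiv.prodProdProdComm _ _ _ _) fun r => ?_
        simp only [mem_filter, mem_product, Equiv.prodProdProdComm_apply, psi, Prod.mk.injEq]
        constructor
        · rintro ⟨⟨⟨h1, h3⟩, h1', h3'⟩, hv, hy⟩
          exact ⟨⟨⟨h1, h1'⟩, h3, h3'⟩, by linear_combination hv, hy⟩
        · rintro ⟨⟨⟨h1, h1'⟩, h3, h3'⟩, hv, hy⟩
          exact ⟨⟨⟨h1, h3⟩, h1', h3'⟩, by linear_combination hv, hy⟩
    _ = _ := by
        rw [card_filter_product_right]
        rfl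

/-- **Diagonal slices**: if `val p₃ = val p₃'` then `G(t) ≤ 2 · #pts` (`y₁ = y₁'` and
`x₁²y₁³ = x₁'²y₁³` force `x₁' = ±x₁`). [folklore] -/
theorem sliceCount_le_of_eq {t : (ℤ × ℤ) × (ℤ × ℤ)} (h0 : val t.1 = val t.2) :
    sliceCount X Y t ≤ 2 * #(pts X Y) := by
  unfold sliceCount
  rw [card_filter_product_right]
  calc _ ≤ ∑ p' ∈ pts X Y, 2 := sum_le_sum fun p' hp' => ?_
    _ = 2 * #(pts X Y) := by rw [sum_const, smul_eq_mul, mul_comm]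
  have hy0 : p'.2 ≠ 0 := (mem_pts.1 hp').2.2.1
  calc #{p ∈ pts X Y | val (p, p').1 - val (p, p').2 = val t.1 - val t.2 ∧ (p, p').1.2 = (p, p').2.2}
      ≤ #{x ∈ xdom X | x ^ 2 * p'.2 ^ 3 = val p'} := by
        refine card_le_card_of_injOn Prod.fst ?_ ?_
        · intro p hp
          obtain ⟨hmem, hv, hy⟩ := mem_filter.1 (mem_coe.1 hp)
          refine mem_coe.2 (mem_filter.2 ⟨(mem_product.1 hmem).1, ?_⟩)
          have hv' : val p = val p' := by linear_combination hv + h0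
          simpa only [val, show p.2 = p'.2 from hy] using hv'
        · intro p hp q hq heq
          obtain ⟨-, -, hp2⟩ := mem_filter.1 (mem_coe.1 hp)
          obtain ⟨-, -, hq2⟩ := mem_filter.1 (mem_coe.1 hq)
          exact Prod.ext heq (by simp only at hp2 hq2; rw [hp2, hq2])
    _ ≤ 2 := card_filter_sq_mul_eq_le_two _ (pow_ne_zero 3 hy0) _

/-- **Off-diagonal slices**: if `m = val p₃ − val p₃' ≠ 0` then `G(t) ≤ 2τ(|m|) · 2τ(|m|)`
(inject `(p₁, p₁') ↦ (y₁, x₁, x₁')` into the solutions of `y³(a² − b²) = m`). [folklore] -/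
theorem sliceCount_le_of_ne {t : (ℤ × ℤ) × (ℤ × ℤ)} (h0 : val t.1 ≠ val t.2) :
    sliceCount X Y t ≤ 2 * tau (val t.1 - val t.2) * (2 * tau (val t.1 - val t.2)) := by
  unfold sliceCount
  have hm : val t.1 - val t.2 ≠ 0 := sub_ne_zero.2 h0
  calc _ ≤ #{w ∈ ydom Y ×ˢ (xdom X ×ˢ xdom X) |
        w.1 ^ 3 * (w.2.1 ^ 2 - w.2.2 ^ 2) = val t.1 - val t.2} := by
        refine card_le_card_of_injOn (fun s => (s.1.2, (s.1.1, s.2.1))) ?_ ?_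
        · intro s hs
          obtain ⟨hmem, hv, hy⟩ := mem_filter.1 (mem_coe.1 hs)
          obtain ⟨h1, h2⟩ := mem_product.1 hmem
          refine mem_coe.2 (mem_filter.2 ⟨mem_product.2 ⟨(mem_product.1 h1).2,
            mem_product.2 ⟨(mem_product.1 h1).1, (mem_product.1 h2).1⟩⟩, ?_⟩)
          show s.1.2 ^ 3 * (s.1.1 ^ 2 - s.2.1 ^ 2) = val t.1 - val t.2
          rw [← hv]
          simp only [val]
          rw [← hy]
          ring
        · intro s hs s' hs' heq
          obtain ⟨-, -, hy⟩ := mem_filter.1 (mem_coe.1 hs)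
          obtain ⟨-, -, hy'⟩ := mem_filter.1 (mem_coe.1 hs')
          simp only [Prod.mk.injEq] at heq
          obtain ⟨e2, e1, e1'⟩ := heq
          refine Prod.ext (Prod.ext e1 e2) (Prod.ext e1' ?_)
          rw [← hy, ← hy', e2]
    _ ≤ _ := card_filter_cube_mul_le _ _ _ (fun y hy => ne_zero_of_mem_ydom hy) hm

/-- The number of diagonal `t`: `#{(p₃, p₃') : val p₃ = val p₃'} ≤ Σ_{p'} 4τ(|val p'|)`.
[folklore] -/
theorem card_filter_val_eq_val_le (X Y : ℕ) :
    #{t ∈ pts X Y ×ˢ pts X Y | val t.1 = val t.2} ≤ ∑ p' ∈ pts X Y, 4 * tau (val p') := by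
  rw [card_filter_product_right]
  exact sum_le_sum fun p' hp' => card_filter_val_eq_le X Y (val_ne_zero hp')

end Slices

end Shute2021

end Literature.NumberTheory.DiophantineGeometry
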